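import Mathlib
import Literature.Probability.RandomPlanarGeometry.CardyFunctionIncBeta
import HarnessLib

/-!
# Cardy's equation `3η(1-η) φ'' + 2(1-2η) φ' = 0` integrates to `A · cardyFunction + B`

Topic `Literature/Probability/RandomPlanarGeometry`; one theorem.  Cardy's function
`F = cardyFunction` satisfies `F'(η) = (cardyConst/3) (η(1-η))^{-2/3}` on `(0,1)`
(`hasDerivAt_cardyFunction_holds`, Cardy 1992 eq. (8)), i.e. it solves the hypergeometric /
Riemann equation `3η(1-η) F'' + 2(1-2η) F' = 0` whose solution space is `{A F + B}`.  We prove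
the uniqueness half used by the crux line `crossing-martingale` of `CardyRigidity`
(stmt-CriticalPhenomena-0746): a `C²` function on `(0,1)` (given with its first two derivatives
as `HasDerivAt` data) solving Cardy's equation is `A · cardyFunction + B` on `(0,1)`
(`exists_eqOn_cardyFunction_affine_of_cardyODE`).  Proof: `φ' (η(1-η))^{2/3}` has zero
derivative, so `φ' = C (η(1-η))^{-2/3} = (3C/cardyConst) F'`, and `φ - (3C/cardyConst) F` has
zero derivative on the connected open interval.

Mathlib: `HasDerivAt.rpow_const`, `IsOpen.exists_is_const_of_deriv_eq_zero`.  (A Summits-side copy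
of this integration step, phrased with the crux's `betaLaw`, exists in
`Summits/CriticalPhenomena/CardyFormulaZ2/Theorems/CardyUniqueLimitCardyRigidityFarFieldBase.lean`,
`AffineBeta.affine_cardy_of_ode`; the present file is the crux-independent Literature statement next
to `cardyFunction`'s own API.)

References: J. Cardy, J. Phys. A 25 (1992), eq. (8); W. Werner, *Lectures on two-dimensional
critical percolation* (2007), §3.
-/

noncomputable section

open Set Filter Topology

namespace Literature.Probability.RandomPlanarGeometry

/-- **Integration of Cardy's equation.**  If `φ` has derivative `φ'` and `φ'` has derivative
`φ''` on `(0,1)`, and `3η(1-η) φ''(η) + 2(1-2η) φ'(η) = 0` for all `η ∈ (0,1)`, then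
`φ = A · cardyFunction + B` on `(0,1)` for some constants `A, B`. [cite: Cardy1992, eq. (8)] -/
theorem exists_eqOn_cardyFunction_affine_of_cardyODE {φ φ' φ'' : ℝ → ℝ}
    (hφ : ∀ η ∈ Ioo (0 : ℝ) 1, HasDerivAt φ (φ' η) η)
    (hφ' : ∀ η ∈ Ioo (0 : ℝ) 1, HasDerivAt φ' (φ'' η) η)
    (hode : ∀ η ∈ Ioo (0 : ℝ) 1, 3 * η * (1 - η) * φ'' η + 2 * (1 - 2 * η) * φ' η = 0) :
    ∃ A B : ℝ, EqOn φ (fun η ↦ A * cardyFunction η + B) (Ioo 0 1) := by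
  -- `k = φ' · (η(1-η))^{2/3}` has zero derivative on `(0,1)`
  set k : ℝ → ℝ := fun η ↦ φ' η * (η * (1 - η)) ^ (2 / 3 : ℝ) with hk
  have hbase : ∀ η ∈ Ioo (0 : ℝ) 1, 0 < η * (1 - η) := fun η hη ↦
    mul_pos hη.1 (by linarith [hη.2])
  have hkd : ∀ η ∈ Ioo (0 : ℝ) 1, HasDerivAt k 0 η := by
    intro η hη
    have hB := hbase η hη
    have h1 : HasDerivAt (fun y : ℝ ↦ y * (1 - y)) (1 * (1 - η) + η * -1) η :=
      (hasDerivAt_id η).mul ((hasDerivAt_id η).const_sub 1)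
    have h2 : HasDerivAt (fun y : ℝ ↦ (y * (1 - y)) ^ (2 / 3 : ℝ))
        ((1 * (1 - η) + η * -1) * (2 / 3 : ℝ) * (η * (1 - η)) ^ (2 / 3 - 1 : ℝ)) η :=
      h1.rpow_const (Or.inl hB.ne')
    have h3 : HasDerivAt k (φ'' η * (η * (1 - η)) ^ (2 / 3 : ℝ) +
        φ' η * ((1 * (1 - η) + η * -1) * (2 / 3 : ℝ) * (η * (1 - η)) ^ (2 / 3 - 1 : ℝ))) η :=
      (hφ' η hη).mul h2
    refine h3.congr_deriv ?_
    have hsplit : (η * (1 - η)) ^ (2 / 3 : ℝ) = (η * (1 - η)) ^ (2 / 3 - 1 : ℝ) * (η * (1 - η)) := by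
      conv_lhs => rw [show (2 / 3 : ℝ) = (2 / 3 - 1) + 1 by norm_num, Real.rpow_add hB, Real.rpow_one]
    rw [hsplit]
    have hode' := hode η hη
    have : φ'' η * ((η * (1 - η)) ^ (2 / 3 - 1 : ℝ) * (η * (1 - η))) +
        φ' η * ((1 * (1 - η) + η * -1) * (2 / 3 : ℝ) * (η * (1 - η)) ^ (2 / 3 - 1 : ℝ)) =
        (η * (1 - η)) ^ (2 / 3 - 1 : ℝ) / 3 *
          (3 * η * (1 - η) * φ'' η + 2 * (1 - 2 * η) * φ' η) := by ring
    rw [this, hode', mul_zero]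
  obtain ⟨C, hC⟩ := isOpen_Ioo.exists_is_const_of_deriv_eq_zero isPreconnected_Ioo
    (fun η hη ↦ (hkd η hη).differentiableAt.differentiableWithinAt)
    (fun η hη ↦ (hkd η hη).deriv)
  -- hence `φ' = C (η(1-η))^{-2/3} = (3C/cardyConst) F'`
  have hφ'_eq : ∀ η ∈ Ioo (0 : ℝ) 1, φ' η = C * (η * (1 - η)) ^ (-(2 / 3 : ℝ)) := by
    intro η hη
    have hB := hbase η hη
    have hkη : φ' η * (η * (1 - η)) ^ (2 / 3 : ℝ) = C := hC η hη
    have hpow : (η * (1 - η)) ^ (2 / 3 : ℝ) * (η * (1 - η)) ^ (-(2 / 3 : ℝ)) = 1 := by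
      rw [← Real.rpow_add hB]; norm_num
    calc φ' η = φ' η * ((η * (1 - η)) ^ (2 / 3 : ℝ) * (η * (1 - η)) ^ (-(2 / 3 : ℝ))) := by
          rw [hpow, mul_one]
      _ = C * (η * (1 - η)) ^ (-(2 / 3 : ℝ)) := by rw [← mul_assoc, hkη]
  have hcC : cardyConst ≠ 0 := cardyConst_pos.ne'
  set A := 3 * C / cardyConst with hA
  have hψd : ∀ η ∈ Ioo (0 : ℝ) 1, HasDerivAt (fun η ↦ φ η - A * cardyFunction η) 0 η := by
    intro η hη
    have hF := hasDerivAt_cardyFunction_holds hη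
    refine ((hφ η hη).sub (hF.const_mul A)).congr_deriv ?_
    rw [hφ'_eq η hη, hA]
    field_simp
    ring
  obtain ⟨B, hB⟩ := isOpen_Ioo.exists_is_const_of_deriv_eq_zero isPreconnected_Ioo
    (fun η hη ↦ (hψd η hη).differentiableAt.differentiableWithinAt)
    (fun η hη ↦ (hψd η hη).deriv)
  refine ⟨A, B, fun η hη ↦ ?_⟩
  have := hB η hη
  simp only at this ⊢
  linarith

end Literature.Probability.RandomPlanarGeometry

end
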